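import Literature.AlgebraicGeometry.Motives.HodgeNumberFamilySemicontinuity
import Literature.AlgebraicGeometry.HodgeTheory.AnalytificationImmersiveClosedImmersion
import Literature.AlgebraicGeometry.HodgeTheory.RelativeHyperplaneClassHodgeRiemann
import HarnessLib

/-!
# A smooth quasi-projective complex variety carries a Kähler metric (Fubini–Study pulled back along an immersion into `ℙᴺ`)

Layer `Literature/AlgebraicGeometry/Motives`; theorems only (no definition, no named fact). Written by the prover seat
`hodge-nonav-20241-p1` (g19, cell `hodge-nonav`) as brick K7a of prover-Bx g17's programme «GRIFFITHS-HOLOMORPHY» (memo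
`HOME/memos/PROGRAMME-GRIFFITHS-HOLOMORPHY-Bx-g17.md`; target `Griffiths1968_holomorphicHodgeSubbundlesQP`, `--supports stmt-HodgeConjecture-19716`):
the hypothesis `(G, hG)` — a Kähler metric on the total space `𝒳(ℂ)` — of the harmonic-transport bricks K0/K1/K3, for a smooth
QUASI-PROJECTIVE `𝒳` (the binder `IsQuasiProjectiveOver 𝒳` of the QP statement).

`IsQuasiProjectiveOver 𝒳` gives an open immersion `j : 𝒳 ⟶ P` into a projective `P` which need NOT be smooth, so the Kähler structure is
not pulled back from `P(ℂ)`; instead `ε = j ≫ ι_P : 𝒳 ⟶ ℙᴺ` is a preimmersion (`IsQuasiProjectiveOver.exists_isPreimmersion`), `ℙᴺ(ℂ)`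
with its algebraic-chart atlas is a Kähler manifold (`isKaehlerManifold_of_isAnalytification_of_isClosedImmersion_holds`, Fubini–Study;
Griffiths–Harris Ch. 0 §7), `ε(ℂ)` is holomorphic (GAGA functoriality `IsAnalytification.mdifferentiable_comp_map_holds`) with INJECTIVE
complex differential at every point because a preimmersion is surjective on stalks
(`IsAnalytification.injective_mfderiv_of_stalkMap_surjective`, Serre GAGA §2 n°6), hence injective real differential commuting with
`J`; so the Kähler metric pulls back (`Geometry.Kaehler.exists_isKaehler_inner_eq_pullback`: a closed positive `(1,1)`-form restricts
to a closed positive `(1,1)`-form along a `J`-holomorphic immersion; Voisin I §3.1.3, Griffiths–Harris p. 109 «a complex submanifold of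
a Kähler manifold is Kähler»).

* `exists_isKaehler_of_isQuasiProjectiveOver` — for `𝒳` smooth of relative dimension `e` and separated over `ℂ`, quasi-projective:
  `∃ G : ContMDiffRiemannianMetric … (ComplexPoints 𝒳), G.toRiemannianMetric.IsKaehler` on the algebraic-chart atlas
  `chartedSpaceOfCharts (ComplexPoints.algebraicChart 𝒳 e)` (the atlas of F-E ∕ `HodgeNumberFamilySemicontinuity` §Atlas; the special
  case of an open immersion into a SMOOTH projective variety is the `§j(ℂ)` step of `eventually_finrank_hodgePQ_le_of_isOpenImmersion`).

Honest scope: plumbing; nothing here says HC or any rung is proved.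

## References

* [GriffithsHarris1978] P. Griffiths, J. Harris, Principles of Algebraic Geometry (1978), Ch. 0 §7 (the Fubini–Study metric; complex
  submanifolds of Kähler manifolds are Kähler, p. 109).
* [VoisinHodgeI2002] C. Voisin, Hodge Theory and Complex Algebraic Geometry I (2002), §3.1.3, §3.2.1 (projective manifolds are Kähler).
* [SerreGAGA1956] J.-P. Serre, Géométrie algébrique et géométrie analytique (1956), §2 n°5–6.
-/

noncomputable section

open scoped Manifold ContDiff Topology
open CategoryTheory AlgebraicGeometry Bundle Set Filter Function Module
open Literature.NumberTheory.Transcendental Literature.Geometry.Kaehler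
open Literature.AlgebraicGeometry.HodgeTheory Literature.AlgebraicTopology.SingularHomology

namespace Literature.AlgebraicGeometry.Motives

/-- **A smooth quasi-projective complex variety is a Kähler manifold**: for `𝒳` smooth of relative dimension `e` and separated over
`ℂ` with `IsQuasiProjectiveOver 𝒳`, the complex manifold `𝒳(ℂ)` (algebraic-chart atlas) carries a `C^∞` Riemannian metric which is
Kähler for the tangent complex structure — the Fubini–Study metric of `ℙᴺ(ℂ)` pulled back along the analytified preimmersion
`𝒳 ⟶ ℙᴺ`. [cite: GriffithsHarris1978, Ch. 0 §7 (p. 109)] [cite: VoisinHodgeI2002, §3.1.3 and §3.2.1] [cite: SerreGAGA1956, §2 n°6] -/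
theorem exists_isKaehler_of_isQuasiProjectiveOver {𝒳 : SchemeOver ℂ} {e : ℕ} [SmoothOfRelativeDimension e 𝒳.hom]
    [LocallyOfFiniteType 𝒳.hom] [IsSeparated 𝒳.hom] (h𝒳 : IsQuasiProjectiveOver 𝒳) :
    letI := chartedSpaceOfCharts (ComplexPoints.algebraicChart 𝒳 e) (ComplexPoints.mem_algebraicChart_source 𝒳 e)
    haveI : IsManifold 𝓘(ℂ, Fin e → ℂ) ω (ComplexPoints 𝒳) := isManifold_algebraicChart 𝒳 e
    haveI : IsManifold 𝓘(ℝ, Fin e → ℂ) ∞ (ComplexPoints 𝒳) := isManifold_real_of_isManifold_complex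
    ∃ G : ContMDiffRiemannianMetric 𝓘(ℝ, Fin e → ℂ) ∞ (Fin e → ℂ)
        (fun x : ComplexPoints 𝒳 ↦ TangentSpace 𝓘(ℝ, Fin e → ℂ) x),
      G.toRiemannianMetric.IsKaehler := by
  classical
  /- ### Instances and the algebraic atlas of `𝒳(ℂ)` -/
  haveI : Smooth 𝒳.hom := SmoothOfRelativeDimension.smooth e _
  haveI : T2Space (ComplexPoints 𝒳) := ComplexPoints.t2Space_of_isSeparated 𝒳
  letI csT : ChartedSpace (Fin e → ℂ) (ComplexPoints 𝒳) :=
    chartedSpaceOfCharts (ComplexPoints.algebraicChart 𝒳 e) (ComplexPoints.mem_algebraicChart_source 𝒳 e)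
  haveI : IsManifold 𝓘(ℂ, Fin e → ℂ) ω (ComplexPoints 𝒳) := isManifold_algebraicChart 𝒳 _
  haveI : IsManifold 𝓘(ℝ, Fin e → ℂ) ∞ (ComplexPoints 𝒳) := isManifold_real_of_isManifold_complex
  have hφT : IsAnalytification (Fin e → ℂ) 𝒳 e (id : ComplexPoints 𝒳 → _) := isAnalytification_algebraicChart 𝒳 _
  /- ### The preimmersion `ε : 𝒳 ⟶ ℙᴺ` and the atlas of `ℙᴺ(ℂ)` -/
  obtain ⟨N, ε, hε⟩ := h𝒳.exists_isPreimmersion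
  haveI := hε
  have hP : IsSmoothProjective N (projectiveSpace N ℂ) := isSmoothProjective_projectiveSpace' N
  haveI : SmoothOfRelativeDimension N (projectiveSpace N ℂ).hom := hP.smoothOfRelativeDimension
  haveI : IsProper (projectiveSpace N ℂ).hom := IsSmoothProjective.isProper_holds hP
  haveI : Smooth (projectiveSpace N ℂ).hom := SmoothOfRelativeDimension.smooth N _
  haveI : LocallyOfFiniteType (projectiveSpace N ℂ).hom := inferInstance
  haveI : T2Space (ComplexPoints (projectiveSpace N ℂ)) := ComplexPoints.t2Space_of_isSeparated (projectiveSpace N ℂ)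
  letI csX : ChartedSpace (Fin N → ℂ) (ComplexPoints (projectiveSpace N ℂ)) :=
    chartedSpaceOfCharts (ComplexPoints.algebraicChart (projectiveSpace N ℂ) N)
      (ComplexPoints.mem_algebraicChart_source (projectiveSpace N ℂ) N)
  haveI : IsManifold 𝓘(ℂ, Fin N → ℂ) ω (ComplexPoints (projectiveSpace N ℂ)) := isManifold_algebraicChart (projectiveSpace N ℂ) _
  haveI : IsManifold 𝓘(ℝ, Fin N → ℂ) ∞ (ComplexPoints (projectiveSpace N ℂ)) := isManifold_real_of_isManifold_complex
  have hφX : IsAnalytification (Fin N → ℂ) (projectiveSpace N ℂ) N (id : ComplexPoints (projectiveSpace N ℂ) → _) :=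
    isAnalytification_algebraicChart (projectiveSpace N ℂ) _
  /- ### `ℙᴺ(ℂ)` is Kähler (Fubini–Study through the identity closed immersion `ℙᴺ ⟶ ℙᴺ'`) -/
  obtain ⟨N', ι, hι⟩ := hP.isProjectiveOver
  haveI := hι
  haveI : IsKaehlerManifold (Fin N → ℂ) (ComplexPoints (projectiveSpace N ℂ)) :=
    isKaehlerManifold_of_isAnalytification_of_isClosedImmersion_holds ι hφX
  obtain ⟨GX, hGX⟩ := IsKaehlerManifold.exists_isKaehler (E := Fin N → ℂ) (M := ComplexPoints (projectiveSpace N ℂ))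
  /- ### `ε(ℂ)`: holomorphic with injective differential (a preimmersion is surjective on stalks) -/
  have hjhol : MDifferentiable 𝓘(ℂ, Fin e → ℂ) 𝓘(ℂ, Fin N → ℂ)
      (AlgPoints.map ε : ComplexPoints 𝒳 → ComplexPoints (projectiveSpace N ℂ)) :=
    IsAnalytification.mdifferentiable_comp_map_holds hφT hφX ε (AlgPoints.map ε) rfl
  have hjD : ∀ x, Injective (mfderiv 𝓘(ℝ, Fin e → ℂ) 𝓘(ℝ, Fin N → ℂ)
      (AlgPoints.map ε : ComplexPoints 𝒳 → ComplexPoints (projectiveSpace N ℂ)) x) := fun x ↦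
    injective_mfderiv_real_of_complex (hjhol x)
      (hφT.injective_mfderiv_of_stalkMap_surjective hφX ε (AlgPoints.map ε) rfl x (ε.left.stalkMap_surjective _))
  /- ### pull back -/
  obtain ⟨GT, hGT, -⟩ := exists_isKaehler_inner_eq_pullback GX hGX hjhol.contMDiff_real_of_complex
    (fun x v ↦ mfderiv_real_tangentJ (hjhol x) v) hjD
  exact ⟨GT, hGT⟩

end Literature.AlgebraicGeometry.Motives

end
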